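import Literature.NumberTheory.Transcendental.KZDominatedFamilyRelations
import Summits.KontsevichZagierPeriods.KontsevichZagierPeriods.Theorems.ReducedPeriodRing.Negative.DimZero

/-!
# Route ValuedFieldSpecialisation — crux `CTConstruction`: special-fibre rigidity in fibre dimension `0`

Helper toward crux stmt-KontsevichZagierPeriods-3495 (`CTConstruction`), line `registered`, stub
`stub_specialFibreRigidityOfEval` (the class-level core: a special-fibre combination `y` of a fibred
relation among normal forms, known to satisfy `eval y = 0`, is a KZ relation). This file settles the layer
of `y` generated by special fibres of dimension `0` (constants): on the subgroup of `KZ.FormalRep`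
generated by the classes of `0`-dimensional representations, the kernel of `KZ.eval` IS `KZ.relations` —
already in the tree as `Summit.KontsevichZagierPeriods.KontsevichZagierPeriods.ReducedPeriodRingNegative.dimZero_kernel`
(route ReducedPeriodRing), reused here. Consequently the dimension-`0` instances of the rigidity stub hold
outright, with no fibred relation and no elementary part needed (`stub_specialFibreRigidityOfEval_dimZero`, registered sub-goal of the crux).

Sources: M. Kontsevich, D. Zagier, *Periods* (2001), §1.2 (rule (1)). Deliberately NOT here: anything
about special fibres of positive dimension (the open core of the crux).
-/

noncomputable section

namespace Summit.KontsevichZagierPeriods.ValuedFieldSpecialisation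

open MeasureTheory Set Filter
open Literature.NumberTheory.Transcendental Literature.NumberTheory.Transcendental.KZ

/-- The second components of the subgroup generated by the dominated pairs `([S], [r₀])` with
`S : IntegralRep (0 + 1)` lie in the subgroup generated by the `0`-dimensional classes. [folklore] -/
theorem snd_mem_closure_dimZero_of_mem_closure_dominatedPairs₀ {v : FormalRep × FormalRep}
    (hv : v ∈ AddSubgroup.closure {v : FormalRep × FormalRep | ∃ (S : IntegralRep (0 + 1))
      (r₀ g : IntegralRep 0), IsDominatedFamily S r₀ g ∧ v = (of S, of r₀)}) :
    v.2 ∈ AddSubgroup.closure (Set.range fun r : IntegralRep 0 => of r) := by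
  induction hv using AddSubgroup.closure_induction with
  | mem w hw =>
    obtain ⟨S, r₀, g, -, rfl⟩ := hw
    exact AddSubgroup.subset_closure ⟨r₀, rfl⟩
  | zero => exact zero_mem _
  | add w w' _ _ ih ih' => exact add_mem ih ih'
  | neg w _ ih => exact neg_mem ih

/-- **Special-fibre rigidity in fibre dimension `0`** (the dimension-`0` instances of stub
`stub_specialFibreRigidityOfEval` of crux `CTConstruction`, line `registered`): for `(G, y)` in the
subgroup generated by the dominated pairs `([S], [r₀])` with `S` a ONE-dimensional family (special fibres
of dimension `0`), `eval y = 0` already forces `y ∈ KZ.relations` (by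
`ReducedPeriodRingNegative.dimZero_kernel`: a `ℤ`-combination of constants of total value `0` is a
relation) — no fibred relation is needed. [Kontsevich–Zagier 2001, §1.2 rule (1)] [folklore] -/
theorem stub_specialFibreRigidityOfEval_dimZero : ∀ (G y : Literature.NumberTheory.Transcendental.KZ.FormalRep), (G, y) ∈ AddSubgroup.closure {v : Literature.NumberTheory.Transcendental.KZ.FormalRep × Literature.NumberTheory.Transcendental.KZ.FormalRep | ∃ (S : Literature.NumberTheory.Transcendental.KZ.IntegralRep (0 + 1)) (r₀ g : Literature.NumberTheory.Transcendental.KZ.IntegralRep 0), Literature.NumberTheory.Transcendental.KZ.IsDominatedFamily S r₀ g ∧ v = (Literature.NumberTheory.Transcendental.KZ.of S, Literature.NumberTheory.Transcendental.KZ.of r₀)} → Literature.NumberTheory.Transcendental.KZ.eval y = 0 → y ∈ Literature.NumberTheory.Transcendental.KZ.relations :=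
  fun _ _ hGy h0 =>
  Summit.KontsevichZagierPeriods.KontsevichZagierPeriods.ReducedPeriodRingNegative.dimZero_kernel
    (snd_mem_closure_dimZero_of_mem_closure_dominatedPairs₀ hGy) h0

end Summit.KontsevichZagierPeriods.ValuedFieldSpecialisation
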